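import Literature.Analysis.FunctionSpaces.LatticeChainFourier
import Literature.Analysis.FunctionSpaces.LatticeDispersion
import Literature.Analysis.FunctionSpaces.TorusScalarTrigPoly
import Mathlib.MeasureTheory.Measure.Haar.Unique
import Mathlib.MeasureTheory.Group.Integral
import HarnessLib

/-!
# A finitely supported real kernel whose Fourier multiplier inverts the lattice Laplacian in `L²`:
`∫_{T^d} (μ · p̂ - 1)² ≤ η`

Analysis/FunctionSpaces support file (module "P2") for the lattice potential theory of `ℤ^d`
(proof programme of the named fact
`Literature.MathematicalPhysics.QuantumFieldTheory.FrohlichSpencerU1PerimeterLawD4`,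
Fröhlich–Spencer 1982 §2.5 (2.32)–(2.36) / (2.88): we replace the infinite-volume Green's
function `(-Δ)⁻¹` by a finitely supported real, even kernel `p` whose Fourier transform
`p̂ = P_N g_δ` (the Fourier truncation of the truncated inverse dispersion
`g_δ = 1_{μ>δ} μ⁻¹`) satisfies `‖μ p̂ - 1‖_{L²(T^d)} ≤ η` for any prescribed `η > 0`; convolution
with `p` then produces the finitely supported test chains of the variational bound
`CubicalChainsPairing.pair₂_sub_div₃_self_le`). Everything is proved; no named fact is introduced.

* `latticeDispersion_le_card` (`μ ≤ 4d`), `latticeDispersion_neg` (`μ` is even),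
  `mFourier_neg_arg` (`e_n(-x) = conj e_n(x)`);
* `truncInv δ = 1_{μ>δ} μ⁻¹`: bounded by `δ⁻¹`, measurable, even, in `L²`;
* `im_mFourierCoeff_eq_zero_of_even` (**Fourier coefficients of even real functions are real**,
  by the negation invariance of the Haar volume);
* `greenKernel δ N` (the kernel `p`, supported in `freqBall N`, even) with
  `latFT_greenKernel : p̂ = P_N g_δ` (`Torus.scalarTruncate`);
* `volume_latticeDispersion_eq_zero` (`{μ = 0}` is null), `tendsto_volume_latticeDispersion_le`
  (`vol{μ ≤ δ} → 0` as `δ ↓ 0`);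
* `exists_greenKernel` (**main**): `∀ η > 0, ∃ δ N, ∫ (μ · P_N g_δ - 1)² ≤ η`
  (`(μ P_N g - 1)² ≤ 2 (4d)² (P_N g - g)² + 2 · 1_{μ ≤ δ}` and the Parseval tail
  `∫ (g - P_N g)² → 0` of `TorusScalarTrigPoly`).

## References

* J. Fröhlich, T. Spencer, Comm. Math. Phys. 83 (1982) 411–454, §2.5, §2.10 (2.88). [FrohlichSpencerCMP1982]
* L. Grafakos, *Classical Fourier Analysis*, 3rd ed. (2014), Prop. 3.2.7 (Parseval / `L²` convergence of
  square partial sums), as vendored in `TorusScalarTrigPoly`. [Grafakos2014]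
-/

noncomputable section

open MeasureTheory Set Filter Complex Finset Function Topology
open scoped Real ENNReal ComplexConjugate

namespace Literature.Analysis.FunctionSpaces

namespace LatticeFourier

open Literature.Analysis.FunctionSpaces.Torus (trigPoly reTrigPoly scalarTruncate freqBall)

/-! ### Symmetries and size of the dispersion -/

section Dispersion

variable {ι : Type*} [Fintype ι]

/-- `μ ≤ 4 · card`. [folklore] -/
theorem latticeDispersion_le_card (x : UnitAddTorus ι) :
    latticeDispersion x ≤ 4 * Fintype.card ι := by
  unfold latticeDispersion
  have h : ∀ i ∈ (Finset.univ : Finset ι), ‖(fourier 1 (x i) : ℂ) - 1‖ ^ 2 ≤ 4 := fun i _ => by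
    have h1 : ‖(fourier 1 (x i) : ℂ) - 1‖ ≤ 2 := by
      refine (norm_sub_le _ _).trans ?_
      rw [fourier_apply, Circle.norm_coe, norm_one]
      norm_num
    nlinarith [norm_nonneg ((fourier 1 (x i) : ℂ) - 1)]
  refine (Finset.sum_le_sum h).trans ?_
  simp [mul_comm]

omit [Fintype ι] in
/-- `𝐞_n(-t) = conj 𝐞_n(t)` on the circle. [folklore] -/
theorem fourier_neg_arg (n : ℤ) (t : UnitAddCircle) : (fourier n (-t) : ℂ) = conj (fourier n t) := by
  rw [fourier_apply, smul_neg, fourier_neg']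

/-- `μ(-x) = μ(x)`. [folklore] -/
theorem latticeDispersion_neg (x : UnitAddTorus ι) : latticeDispersion (-x) = latticeDispersion x := by
  unfold latticeDispersion
  refine Finset.sum_congr rfl fun i _ => ?_
  rw [Pi.neg_apply, fourier_neg_arg, ← Complex.norm_conj ((fourier 1 (x i) : ℂ) - 1), map_sub, map_one]

/-- `e_n(-x) = conj e_n(x)` on the torus. [folklore] -/
theorem mFourier_neg_arg (n : ι → ℤ) (x : UnitAddTorus ι) :
    UnitAddTorus.mFourier n (-x) = conj (UnitAddTorus.mFourier n x) := by
  simp only [UnitAddTorus.mFourier, ContinuousMap.coe_mk, map_prod, Pi.neg_apply, fourier_neg_arg]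

/-- **`{μ = 0}` is a null set** (it lies in a coordinate hyperplane). [folklore] -/
theorem volume_latticeDispersion_eq_zero [Nonempty ι] :
    volume ({x : UnitAddTorus ι | latticeDispersion x = 0}) = 0 := by
  obtain ⟨i₀⟩ := (inferInstance : Nonempty ι)
  have hsub : {x : UnitAddTorus ι | latticeDispersion x = 0} ⊆ Function.eval i₀ ⁻¹' {0} := by
    intro x hx
    simp only [Set.mem_setOf_eq] at hx
    simp only [Set.mem_preimage, Function.eval, Set.mem_singleton_iff]
    have hi : ‖(fourier 1 (x i₀) : ℂ) - 1‖ ^ 2 = 0 := by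
      have hle : ‖(fourier 1 (x i₀) : ℂ) - 1‖ ^ 2 ≤ latticeDispersion x :=
        Finset.single_le_sum (f := fun j => ‖(fourier 1 (x j) : ℂ) - 1‖ ^ 2)
          (fun j _ => sq_nonneg _) (Finset.mem_univ i₀)
      exact le_antisymm (hx ▸ hle) (sq_nonneg _)
    have h1 : (fourier 1 (x i₀) : ℂ) = 1 := by
      rw [sq_eq_zero_iff, norm_eq_zero, sub_eq_zero] at hi
      exact hi
    rw [fourier_one] at h1
    have h2 : AddCircle.toCircle (x i₀) = 1 := Circle.ext (by simpa using h1)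
    exact AddCircle.injective_toCircle one_ne_zero (h2.trans AddCircle.toCircle_zero.symm)
  have h0 : (volume : Measure UnitAddCircle) {0} = 0 := by
    rw [← Metric.closedBall_zero, AddCircle.volume_closedBall]
    simp
  exact measure_mono_null hsub
    (Measure.pi_eval_preimage_null (fun _ : ι => (volume : Measure UnitAddCircle)) h0)

/-- **`vol{μ ≤ δ} → 0` as `δ ↓ 0`**. [folklore] -/
theorem tendsto_volume_latticeDispersion_le [Nonempty ι] :
    Tendsto (fun δ : ℝ => volume {x : UnitAddTorus ι | latticeDispersion x ≤ δ}) (𝓝[>] 0) (𝓝 0) := by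
  have hs : ∀ r > (0 : ℝ), NullMeasurableSet {x : UnitAddTorus ι | latticeDispersion x ≤ r} volume :=
    fun r _ => (measurableSet_le continuous_latticeDispersion.measurable measurable_const).nullMeasurableSet
  have hm : ∀ i j : ℝ, 0 < i → i ≤ j →
      {x : UnitAddTorus ι | latticeDispersion x ≤ i} ⊆ {x | latticeDispersion x ≤ j} :=
    fun i j _ hij x hx => le_trans hx hij
  have hf : ∃ r > (0 : ℝ), volume {x : UnitAddTorus ι | latticeDispersion x ≤ r} ≠ ∞ :=
    ⟨1, one_pos, measure_ne_top _ _⟩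
  have h := tendsto_measure_biInter_gt hs hm hf
  have hI : (⋂ r > (0 : ℝ), {x : UnitAddTorus ι | latticeDispersion x ≤ r}) =
      {x | latticeDispersion x = 0} := by
    ext x
    simp only [Set.mem_iInter, Set.mem_setOf_eq]
    constructor
    · intro hx
      refine le_antisymm (le_of_forall_pos_le_add fun ε hε => ?_) (latticeDispersion_nonneg x)
      simpa using hx ε hε
    · intro hx r hr
      rw [hx]; exact hr.le
  rw [hI, volume_latticeDispersion_eq_zero] at h
  exact h

end Dispersion

/-! ### The truncated inverse dispersion `g_δ = 1_{μ>δ} μ⁻¹` -/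

section TruncInv

variable {ι : Type*} [Fintype ι]

/-- `g_δ(x) = μ(x)⁻¹` if `μ(x) > δ`, and `0` otherwise. [folklore] -/
def truncInv (δ : ℝ) (x : UnitAddTorus ι) : ℝ :=
  if δ < latticeDispersion x then (latticeDispersion x)⁻¹ else 0

/-- `g_δ ≥ 0`. [folklore] -/
theorem truncInv_nonneg (δ : ℝ) (x : UnitAddTorus ι) : 0 ≤ truncInv δ x := by
  unfold truncInv
  split_ifs
  · exact inv_nonneg.2 (latticeDispersion_nonneg x)
  · exact le_rfl

/-- `g_δ ≤ δ⁻¹` for `δ > 0`. [folklore] -/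
theorem truncInv_le {δ : ℝ} (hδ : 0 < δ) (x : UnitAddTorus ι) : truncInv δ x ≤ δ⁻¹ := by
  unfold truncInv
  split_ifs with h
  · exact inv_anti₀ hδ h.le
  · exact inv_nonneg.2 hδ.le

/-- `g_δ` is measurable. [folklore] -/
theorem measurable_truncInv (δ : ℝ) : Measurable (truncInv (ι := ι) δ) := by
  unfold truncInv
  refine Measurable.ite ?_ continuous_latticeDispersion.measurable.inv measurable_const
  exact measurableSet_lt measurable_const continuous_latticeDispersion.measurable

/-- `g_δ` is even. [folklore] -/
theorem truncInv_neg (δ : ℝ) (x : UnitAddTorus ι) : truncInv δ (-x) = truncInv δ x := by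
  simp only [truncInv, latticeDispersion_neg]

/-- `μ g_δ = 1_{μ > δ}`. [folklore] -/
theorem latticeDispersion_mul_truncInv {δ : ℝ} (hδ : 0 < δ) (x : UnitAddTorus ι) :
    latticeDispersion x * truncInv δ x = if δ < latticeDispersion x then 1 else 0 := by
  unfold truncInv
  split_ifs with h
  · exact mul_inv_cancel₀ (ne_of_gt (hδ.trans h))
  · exact mul_zero _

/-- `g_δ ∈ L²` (`δ > 0`). [folklore] -/
theorem memLp_truncInv {δ : ℝ} (hδ : 0 < δ) : MemLp (truncInv (ι := ι) δ) 2 volume :=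
  MemLp.of_bound (measurable_truncInv δ).aestronglyMeasurable δ⁻¹
    (ae_of_all _ fun x => by
      rw [Real.norm_eq_abs, abs_of_nonneg (truncInv_nonneg δ x)]
      exact truncInv_le hδ x)

/-- `g_δ` is integrable (`δ > 0`). [folklore] -/
theorem integrable_truncInv {δ : ℝ} (hδ : 0 < δ) : Integrable (truncInv (ι := ι) δ) volume :=
  (memLp_truncInv hδ).integrable one_le_two

end TruncInv

/-! ### Fourier coefficients of even real functions are real -/

section Even

variable {ι : Type*} [Fintype ι]

/-- **The Fourier coefficients of an even real function are real.** [folklore] -/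
theorem im_mFourierCoeff_eq_zero_of_even {θ : UnitAddTorus ι → ℝ} (hθ : Integrable θ volume)
    (heven : ∀ x, θ (-x) = θ x) (k : ι → ℤ) :
    (UnitAddTorus.mFourierCoeff (fun x => (θ x : ℂ)) k).im = 0 := by
  rw [Torus.im_mFourierCoeff_ofReal hθ k]
  set F : UnitAddTorus ι → ℝ := fun x => θ x * reTrigPoly {-k} (fun _ => -Complex.I) x with hF
  have hodd : ∀ x, F (-x) = -F x := fun x => by
    simp only [hF, ← Torus.im_mFourier_neg, heven, mFourier_neg_arg, Complex.conj_im]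
    ring
  have h1 : ∫ x, F (-x) = ∫ x, F x := integral_neg_eq_self F volume
  have h2 : ∫ x, F (-x) = -∫ x, F x := by
    rw [← integral_neg]
    exact integral_congr_ae (ae_of_all _ fun x => hodd x)
  change ∫ x, F x = 0
  linarith

end Even

/-! ### The kernel -/

section Kernel

variable {d : ℕ}

/-- **The Green kernel** `p = greenKernel δ N`: the real lattice family supported in the
frequency ball `freqBall N` whose values are the (real) Fourier coefficients of `g_δ`, so that
`p̂ = P_N g_δ`. [folklore] -/
def greenKernel (δ : ℝ) (N : ℕ) : (Fin d → ℤ) → ℝ := fun k =>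
  if k ∈ freqBall N then
    (UnitAddTorus.mFourierCoeff (fun x => (truncInv δ x : ℂ)) k).re else 0

/-- The support of the kernel. [folklore] -/
theorem support_greenKernel (δ : ℝ) (N : ℕ) :
    Function.support (greenKernel (d := d) δ N) ⊆ (freqBall N : Finset (Fin d → ℤ)) := by
  intro k hk
  simp only [Function.mem_support, greenKernel, ne_eq, ite_eq_right_iff, Classical.not_imp] at hk
  exact hk.1

/-- The kernel has finite support. [folklore] -/
theorem hasFiniteSupport_greenKernel (δ : ℝ) (N : ℕ) : HasFiniteSupport (greenKernel (d := d) δ N) :=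
  (freqBall N).finite_toSet.subset (support_greenKernel δ N)

/-- The kernel is even. [folklore] -/
theorem greenKernel_neg (δ : ℝ) (N : ℕ) (k : Fin d → ℤ) :
    greenKernel δ N (-k) = greenKernel δ N k := by
  unfold greenKernel
  rw [if_congr Torus.neg_mem_freqBall rfl rfl]
  split_ifs
  · have h := Torus.isConjSymmScalar_mFourierCoeff (truncInv (ι := Fin d) δ) k
    simp only at h
    rw [h, Complex.conj_re]
  · rfl

/-- **`p̂ = P_N g_δ`**: the Fourier transform of the kernel is the real Fourier truncation of
`g_δ` (`δ > 0`). [folklore] -/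
theorem latFT_greenKernel {δ : ℝ} (hδ : 0 < δ) (N : ℕ) (x : UnitAddTorus (Fin d)) :
    latFT (freqBall N) (greenKernel δ N) x = ((scalarTruncate N (truncInv δ) x : ℝ) : ℂ) := by
  have hS : ∀ k ∈ (freqBall N : Finset (Fin d → ℤ)), -k ∈ freqBall N :=
    fun k hk => Torus.neg_mem_freqBall.2 hk
  rw [scalarTruncate, Torus.ofReal_reTrigPoly hS (Torus.isConjSymmScalar_mFourierCoeff _), latFT]
  have hfun : trigPoly (V := ℂ) (freqBall N : Finset (Fin d → ℤ))
        (fun y : Fin d → ℤ => ((greenKernel δ N y : ℝ) : ℂ)) =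
      trigPoly (freqBall N : Finset (Fin d → ℤ)) (fun k : Fin d → ℤ =>
        UnitAddTorus.mFourierCoeff (fun x : UnitAddTorus (Fin d) => (truncInv δ x : ℂ)) k) := by
    refine Torus.trigPoly_congr fun k hk => ?_
    simp only [greenKernel, hk, if_true]
    have him := im_mFourierCoeff_eq_zero_of_even (integrable_truncInv (ι := Fin d) hδ)
      (truncInv_neg δ) k
    apply Complex.ext
    · simp
    · simp [him]
  exact congrFun hfun x

/-- The truncation `P_N g_δ` is continuous. [folklore] -/
theorem continuous_scalarTruncate_truncInv (δ : ℝ) (N : ℕ) :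
    Continuous (scalarTruncate N (truncInv (ι := Fin d) δ)) :=
  Torus.continuous_scalarTruncate N _

end Kernel

/-! ### The main approximation -/

section Main

variable {d : ℕ}

/-- Pointwise: `(μ P - 1)² ≤ 2 (4d)² (P - g_δ)² + 2 · 1_{μ ≤ δ}`. [folklore] -/
theorem sq_dispersion_mul_sub_one_le {δ : ℝ} (hδ : 0 < δ) (P : ℝ) (x : UnitAddTorus (Fin d)) :
    (latticeDispersion x * P - 1) ^ 2 ≤
      2 * (4 * d) ^ 2 * (P - truncInv δ x) ^ 2 +
        2 * Set.indicator {y : UnitAddTorus (Fin d) | latticeDispersion y ≤ δ} 1 x := by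
  have hμ0 := latticeDispersion_nonneg x
  have hμ : latticeDispersion x ≤ 4 * d := by
    simpa using latticeDispersion_le_card (ι := Fin d) x
  have hsplit : latticeDispersion x * P - 1 =
      latticeDispersion x * (P - truncInv δ x) + (latticeDispersion x * truncInv δ x - 1) := by ring
  have hb : (latticeDispersion x * truncInv δ x - 1) ^ 2 =
      Set.indicator {y : UnitAddTorus (Fin d) | latticeDispersion y ≤ δ} 1 x := by
    rw [latticeDispersion_mul_truncInv hδ]
    by_cases h : δ < latticeDispersion x
    · rw [if_pos h, Set.indicator_of_notMem (by simpa using h)]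
      norm_num
    · rw [if_neg h, Set.indicator_of_mem (by simpa using h)]
      norm_num
  have ha : (latticeDispersion x * (P - truncInv δ x)) ^ 2 ≤ (4 * d) ^ 2 * (P - truncInv δ x) ^ 2 := by
    rw [mul_pow]
    exact mul_le_mul_of_nonneg_right (pow_le_pow_left₀ hμ0 hμ 2) (sq_nonneg _)
  rw [hsplit, ← hb]
  nlinarith [sq_nonneg (latticeDispersion x * (P - truncInv δ x) - (latticeDispersion x * truncInv δ x - 1))]

/-- **Main approximation**: for every `η > 0` there are `δ > 0` and `N` with
`∫ (μ · P_N g_δ - 1)² ≤ η` (`d ≥ 1`). [folklore] -/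
theorem exists_greenKernel (hd : 1 ≤ d) {η : ℝ} (hη : 0 < η) :
    ∃ δ : ℝ, 0 < δ ∧ ∃ N : ℕ,
      ∫ x, (latticeDispersion x * scalarTruncate N (truncInv (ι := Fin d) δ) x - 1) ^ 2 ≤ η := by
  haveI : Nonempty (Fin d) := ⟨⟨0, hd⟩⟩
  -- choose `δ` with `vol{μ ≤ δ} ≤ η/4`
  have hvol := tendsto_volume_latticeDispersion_le (ι := Fin d)
  have hev : ∀ᶠ δ : ℝ in 𝓝[>] 0,
      volume {x : UnitAddTorus (Fin d) | latticeDispersion x ≤ δ} < ENNReal.ofReal (η / 4) :=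
    (tendsto_order.1 hvol).2 _ (by simpa using hη)
  obtain ⟨δ, hδvol, hδmem⟩ := (hev.and self_mem_nhdsWithin).exists
  have hδpos : 0 < δ := hδmem
  refine ⟨δ, hδpos, ?_⟩
  -- choose `N` with `∫ (g - P_N g)² ≤ η / (4 (4d)² + 4)`
  set K : ℝ := 2 * (4 * d) ^ 2 with hK
  have hKnn : 0 ≤ K := by positivity
  have htail := Torus.tendsto_integral_sq_sub_scalarTruncate (memLp_truncInv (ι := Fin d) hδpos)
  have hε : 0 < η / (2 * K + 2) := by positivity
  obtain ⟨N, hN⟩ := ((tendsto_order.1 htail).2 _ hε).exists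
  refine ⟨N, ?_⟩
  set g := truncInv (ι := Fin d) δ with hg
  set P := scalarTruncate N g with hP
  set B : Set (UnitAddTorus (Fin d)) := {y | latticeDispersion y ≤ δ} with hB
  have hBm : MeasurableSet B := measurableSet_le continuous_latticeDispersion.measurable measurable_const
  -- integrability of the three players
  have hPc : Continuous P := Torus.continuous_scalarTruncate N _
  have hPg : MemLp (fun x => P x - g x) 2 volume :=
    (Torus.memLp_scalarTruncate N g 2).sub (memLp_truncInv hδpos)
  have hi1 : Integrable (fun x => (P x - g x) ^ 2) volume := hPg.integrable_sq
  have hi2 : Integrable (B.indicator (1 : UnitAddTorus (Fin d) → ℝ)) volume :=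
    (integrable_const 1).indicator hBm
  have hi0 : Integrable (fun x => (latticeDispersion x * P x - 1) ^ 2) volume :=
    (((continuous_latticeDispersion.mul hPc).sub continuous_const).pow 2).integrable_unitAddTorus
  -- pointwise bound and integration
  have hle : ∫ x, (latticeDispersion x * P x - 1) ^ 2 ≤
      ∫ x, (K * (P x - g x) ^ 2 + 2 * B.indicator 1 x) :=
    integral_mono hi0 ((hi1.const_mul K).add (hi2.const_mul 2)) fun x => by
      have := sq_dispersion_mul_sub_one_le hδpos (P x) x
      simpa [hK, hB, mul_assoc] using this
  have hsplit : ∫ x, (K * (P x - g x) ^ 2 + 2 * B.indicator 1 x) =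
      K * (∫ x, (P x - g x) ^ 2) + 2 * (volume B).toReal := by
    rw [integral_add (hi1.const_mul K) (hi2.const_mul 2), integral_const_mul, integral_const_mul,
      integral_indicator_one hBm, measureReal_def]
  have htail' : (∫ x, (P x - g x) ^ 2) < η / (2 * K + 2) := by
    have : (fun x => (P x - g x) ^ 2) = fun x => (g x - scalarTruncate N g x) ^ 2 := by
      funext x; rw [hP]; ring
    rw [this]; exact hN
  have hvolB : (volume B).toReal < η / 4 := by
    have hfin : volume B ≠ ∞ := measure_ne_top _ _
    have := (ENNReal.toReal_lt_toReal hfin ENNReal.ofReal_ne_top).2 hδvol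
    rwa [ENNReal.toReal_ofReal (by positivity)] at this
  have hK1 : K * (η / (2 * K + 2)) ≤ η / 2 := by
    rw [mul_div_assoc']
    rw [div_le_div_iff₀ (by positivity) (by positivity)]
    nlinarith
  calc ∫ x, (latticeDispersion x * P x - 1) ^ 2
      ≤ K * (∫ x, (P x - g x) ^ 2) + 2 * (volume B).toReal := hle.trans (le_of_eq hsplit)
    _ ≤ K * (η / (2 * K + 2)) + 2 * (η / 4) :=
        add_le_add (mul_le_mul_of_nonneg_left htail'.le hKnn) (by linarith [hvolB])
    _ ≤ η := by linarith

end Main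

end LatticeFourier

end Literature.Analysis.FunctionSpaces
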